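import Literature.AlgebraicGeometry.ComplexMultiplication.CyclotomicFermatCMTypesTwoPowerLevelFurthermore
import HarnessLib

/-!
# Koblitz–Rohrlich, THEOREM 4 (`N = 2ⁿ`), families d), e) and the «Furthermore» AT THE PRINTED LEVEL `2ⁿ` for every `0 ≤ m`:
# `H_{(2ᵐ, 2ⁿ⁻¹, 2ⁿ⁻¹−2ᵐ)} = H_{(2ᵐ, 2ᵐ, 2ⁿ−2ᵐ⁺¹)}`, `H_{(2ⁿ⁻¹−2ᵐ, 2ⁿ⁻¹−2ᵐ⁺¹, 3·2ᵐ)} = H_{(2ᵐ, 3·2ᵐ, 2ⁿ−2ᵐ⁺²)}`,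
# `H_{(2ᵐ, 2ⁿ⁻¹−2ᵐ⁺¹, 2ⁿ⁻¹+2ᵐ)} = H_{(2ᵐ⁺¹, 2ⁿ⁻¹, 2ⁿ⁻¹−2ᵐ⁺¹)} = H_{(2ᵐ⁺¹, 2ᵐ⁺¹, 2ⁿ−2ᵐ⁺²)}` modulo `2ⁿ`

Layer `Literature/AlgebraicGeometry/ComplexMultiplication`, namespace `…ComplexMultiplication.CyclotomicFermatCMType`; sequel of
`CyclotomicFermatCMTypesTwoPowerLevelCoincidences` (families d), e): `m = 0` at the level `2ⁿ`, `m ≥ 1` at the level WRITTEN `2ᵐ·2^{n−m}`) and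
`CyclotomicFermatCMTypesTwoPowerLevelFurthermore` (the «Furthermore», same shape).  THEOREMS ONLY (no definition, no named fact, no `sorry`);
no kernel `decide`.

THE SOURCE.  N. Koblitz, D. Rohrlich, *Simple factors in the Jacobian of a Fermat curve*, Canad. J. Math. **30** (1978) 1183–1205, p. 1186:
"THEOREM 4. Suppose `N = 2ⁿ`. Then the only isogenies apart from the obvious ones are between pairs of lattices corresponding to the triples
… d) `(2ᵐ, 3(2ᵐ), 2ⁿ − 2ᵐ⁺²)` and `(2ⁿ⁻¹ − 2ᵐ, 2ⁿ⁻¹ − 2ᵐ⁺¹, 3(2ᵐ))` for `0 ≤ m ≤ n − 4`, or e) `(2ᵐ, 2ⁿ⁻¹, 2ⁿ⁻¹ − 2ᵐ)` and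
`(2ᵐ, 2ᵐ, 2ⁿ − 2ᵐ⁺¹)` for `0 ≤ m ≤ n − 2`.  Furthermore, a lattice of type a)ₘ [`(2ᵐ, 2ⁿ⁻¹ − 2ᵐ⁺¹, 2ⁿ⁻¹ + 2ᵐ)`] is isogenous to the product
of two lattices of type e)ₘ₊₁."  All triples are residues modulo the ONE level `N = 2ⁿ` (§1, p. 1184).

WHAT IS PROVED — exactly these equalities of residue sets `H ⊂ (ℤ/2ⁿ)ˣ` at the level `2ⁿ`, for every `n` and every admissible `m`
(`m + 2 ≤ n`, `m + 4 ≤ n`, `m + 3 ≤ n` respectively), by transporting the siblings' statements at the level written `2ᵐ·2^{n−m}` along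
`2ⁿ = 2ᵐ·2^{n−m}` (a `subst`) and rewriting the entries (`2ᵐ·2^{n−m−1} = 2ⁿ⁻¹`, `2ᵐ(2^{n−m−1} − 1) = 2ⁿ⁻¹ − 2ᵐ`, `2ᵐ(2^{n−m} − 2) = 2ⁿ − 2ᵐ⁺¹`,
`2ᵐ(2^{n−m−1} − 2) = 2ⁿ⁻¹ − 2ᵐ⁺¹`, `2ᵐ(2^{n−m} − 4) = 2ⁿ − 2ᵐ⁺²`, `2ᵐ(2^{n−m−1} + 1) = 2ⁿ⁻¹ + 2ᵐ`); instances at `N = 64` with `m ≥ 1`: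
`H_{(4,32,28)} = H_{(4,4,56)}` (e)₂), `H_{(30,28,6)} = H_{(2,6,56)}` (d)₁), `H_{(2,28,34)} = H_{(4,32,28)} = H_{(4,4,56)}` (a)₁ ∼ e)₂ × e)₂).
This removes the siblings' honest-column caveat "the `m ≥ 1` statements live at the level written `2ᵐ·2^{n−m}` (not rewritten to `2ⁿ`)".

## Honest column / NOT here

* Only the EXISTENCE half of families d), e) and the «Furthermore»; families a), b), c) and the completeness half («the only isogenies»,
  §5 of the paper) remain as in the siblings' honest columns (not treated ∕ illegible in our copy ∕ `N = 8, 16` only).  "Isogeny" = equality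
  of residue sets; the lattice product decomposition is not constructed.
* Nothing new mathematically: pure bookkeeping of levels and powers of `2` over the siblings' theorems (private transport lemma and a private
  list of power identities).

## References

* [KoblitzRohrlich1978] N. Koblitz, D. Rohrlich, Canad. J. Math. 30 (1978) 1183–1205: Theorem 4 (p. 1186), §1 (pp. 1184–1185).

## Provenance

Cell `pub-hodgecm2` (COR-CM), literature seat `lit-deligne-3` gen 36 (claim KR78-THM4-LEVEL-2N; count-neutral, own lane).
-/

open NumberField

namespace Literature.AlgebraicGeometry.ComplexMultiplication

open Literature.AlgebraicGeometry.HodgeTheory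

namespace CyclotomicFermatCMType

/-! ## §1 Transport along an equality of levels; the power-of-two bookkeeping -/

section Transport

/-- Transport of an equality of residue sets of `ℕ`-triples along an equality of levels (private copy). [folklore] -/
private theorem fermatCMType_natCast_eq_transport₂ {N N' : ℕ} [NeZero N] [NeZero N'] (hN : N = N') {a b c a' b' c' : ℕ}
    (h : fermatCMType N' (a : ZMod N') (b : ZMod N') (c : ZMod N') = fermatCMType N' (a' : ZMod N') (b' : ZMod N') (c' : ZMod N')) :
    fermatCMType N (a : ZMod N) (b : ZMod N) (c : ZMod N) = fermatCMType N (a' : ZMod N) (b' : ZMod N) (c' : ZMod N) := by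
  subst hN
  exact h

/-- The powers of two behind the rewriting of the entries (`m + 2 ≤ n`; private). [folklore] -/
private theorem twoPow_entries {n m : ℕ} (hmn : m + 2 ≤ n) :
    2 ^ n = 2 ^ m * 2 ^ (n - m) ∧ 2 ^ m * 1 = 2 ^ m ∧ 2 ^ m * 2 ^ (n - m - 1) = 2 ^ (n - 1) ∧
      2 ^ m * (2 ^ (n - m - 1) - 1) = 2 ^ (n - 1) - 2 ^ m ∧ 2 ^ m * (2 ^ (n - m) - 2) = 2 ^ n - 2 ^ (m + 1) ∧
      2 ^ m * (2 ^ (n - m - 1) - 2) = 2 ^ (n - 1) - 2 ^ (m + 1) ∧ 2 ^ m * (2 ^ (n - m) - 4) = 2 ^ n - 2 ^ (m + 2) ∧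
      2 ^ m * 2 = 2 ^ (m + 1) ∧ 2 ^ m * 3 = 3 * 2 ^ m ∧ 2 ^ m * (2 ^ (n - m - 1) + 1) = 2 ^ (n - 1) + 2 ^ m := by
  have h1 : 2 ^ n = 2 ^ m * 2 ^ (n - m) := by
    rw [← pow_add]
    congr 1
    omega
  have h2 : 2 ^ (n - 1) = 2 ^ m * 2 ^ (n - m - 1) := by
    rw [← pow_add]
    congr 1
    omega
  have h3 : 2 ^ (m + 1) = 2 ^ m * 2 := pow_succ 2 m
  have h4 : 2 ^ (m + 2) = 2 ^ m * 4 := by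
    rw [pow_add]
    norm_num
  refine ⟨h1, mul_one _, h2.symm, ?_, ?_, ?_, ?_, h3.symm, mul_comm _ _, ?_⟩
  · rw [Nat.mul_sub_one, ← h2]
  · rw [Nat.mul_sub, ← h1, ← h3]
  · rw [Nat.mul_sub, ← h2, ← h3]
  · rw [Nat.mul_sub, ← h1, ← h4]
  · rw [mul_add, mul_one, ← h2]

end Transport

/-! ## §2 Family e) at the level `2ⁿ`, `0 ≤ m ≤ n − 2` -/

section FamilyE

variable {n m : ℕ}

/-- **THEOREM 4 e), EVERY `n` and `0 ≤ m ≤ n − 2`, at the level `2ⁿ`**: `H_{(2ᵐ, 2ⁿ⁻¹, 2ⁿ⁻¹ − 2ᵐ)} = H_{(2ᵐ, 2ᵐ, 2ⁿ − 2ᵐ⁺¹)}` modulo `2ⁿ`.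
[cite: KoblitzRohrlich1978, Theorem 4 e) (p. 1186)] -/
theorem fermatCMType_twoPow_e_eq_at_level [NeZero (2 ^ n)] (hmn : m + 2 ≤ n) :
    fermatCMType (2 ^ n) ((2 ^ m : ℕ) : ZMod (2 ^ n)) ((2 ^ (n - 1) : ℕ) : ZMod (2 ^ n)) ((2 ^ (n - 1) - 2 ^ m : ℕ) : ZMod (2 ^ n)) =
      fermatCMType (2 ^ n) ((2 ^ m : ℕ) : ZMod (2 ^ n)) ((2 ^ m : ℕ) : ZMod (2 ^ n)) ((2 ^ n - 2 ^ (m + 1) : ℕ) : ZMod (2 ^ n)) := by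
  haveI : NeZero (2 ^ (n - m)) := ⟨by positivity⟩
  haveI : NeZero (2 ^ m * 2 ^ (n - m)) := ⟨by positivity⟩
  obtain ⟨h1, e1, e2, e3, e4, -, -, -, -, -⟩ := twoPow_entries hmn
  have h := fermatCMType_natCast_eq_transport₂ h1 (fermatCMType_twoPow_e_eq_scaled (n := n) (m := m) hmn)
  rwa [e1, e2, e3, e4] at h

/-- **`N = 64`, e)₂** (`n = 6`, `m = 2`): `H_{(4, 32, 28)} = H_{(4, 4, 56)}`. [cite: KoblitzRohrlich1978, Theorem 4 e) (p. 1186)] -/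
theorem fermatCMType_sixtyFour_e_two : fermatCMType 64 4 32 28 = fermatCMType 64 4 4 56 := by
  have h := fermatCMType_twoPow_e_eq_at_level (n := 6) (m := 2) (by norm_num)
  norm_num at h
  exact h

end FamilyE

/-! ## §3 Family d) at the level `2ⁿ`, `0 ≤ m ≤ n − 4` -/

section FamilyD

variable {n m : ℕ}

/-- **THEOREM 4 d), EVERY `n` and `0 ≤ m ≤ n − 4`, at the level `2ⁿ`**:
`H_{(2ⁿ⁻¹ − 2ᵐ, 2ⁿ⁻¹ − 2ᵐ⁺¹, 3·2ᵐ)} = H_{(2ᵐ, 3·2ᵐ, 2ⁿ − 2ᵐ⁺²)}` modulo `2ⁿ`. [cite: KoblitzRohrlich1978, Theorem 4 d) (p. 1186)] -/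
theorem fermatCMType_twoPow_d_eq_at_level [NeZero (2 ^ n)] (hmn : m + 4 ≤ n) :
    fermatCMType (2 ^ n) ((2 ^ (n - 1) - 2 ^ m : ℕ) : ZMod (2 ^ n)) ((2 ^ (n - 1) - 2 ^ (m + 1) : ℕ) : ZMod (2 ^ n))
        ((3 * 2 ^ m : ℕ) : ZMod (2 ^ n)) =
      fermatCMType (2 ^ n) ((2 ^ m : ℕ) : ZMod (2 ^ n)) ((3 * 2 ^ m : ℕ) : ZMod (2 ^ n)) ((2 ^ n - 2 ^ (m + 2) : ℕ) : ZMod (2 ^ n)) := by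
  haveI : NeZero (2 ^ (n - m)) := ⟨by positivity⟩
  haveI : NeZero (2 ^ m * 2 ^ (n - m)) := ⟨by positivity⟩
  obtain ⟨h1, e1, -, e3, -, e5, e6, -, e8, -⟩ := twoPow_entries (show m + 2 ≤ n by omega)
  have h := fermatCMType_natCast_eq_transport₂ h1 (fermatCMType_twoPow_d_eq_scaled (n := n) (m := m) hmn)
  rwa [e1, e3, e5, e6, e8] at h

/-- **`N = 64`, d)₁** (`n = 6`, `m = 1`): `H_{(30, 28, 6)} = H_{(2, 6, 56)}`. [cite: KoblitzRohrlich1978, Theorem 4 d) (p. 1186)] -/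
theorem fermatCMType_sixtyFour_d_one : fermatCMType 64 30 28 6 = fermatCMType 64 2 6 56 := by
  have h := fermatCMType_twoPow_d_eq_at_level (n := 6) (m := 1) (by norm_num)
  norm_num at h
  exact h

end FamilyD

/-! ## §4 The «Furthermore» at the level `2ⁿ`, `0 ≤ m ≤ n − 3`: `H_{a)ₘ} = H_{e)ₘ₊₁, first} = H_{e)ₘ₊₁, second}` -/

section Furthermore

variable {n m : ℕ}

/-- **THEOREM 4 «Furthermore», EVERY `n` and `0 ≤ m ≤ n − 3`, at the level `2ⁿ`, first e)ₘ₊₁ triple**: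
`H_{(2ᵐ, 2ⁿ⁻¹ − 2ᵐ⁺¹, 2ⁿ⁻¹ + 2ᵐ)} = H_{(2ᵐ⁺¹, 2ⁿ⁻¹, 2ⁿ⁻¹ − 2ᵐ⁺¹)}` modulo `2ⁿ`. [cite: KoblitzRohrlich1978, Theorem 4 (p. 1186)] -/
theorem fermatCMType_twoPow_furthermore_eq_at_level [NeZero (2 ^ n)] (hmn : m + 3 ≤ n) :
    fermatCMType (2 ^ n) ((2 ^ m : ℕ) : ZMod (2 ^ n)) ((2 ^ (n - 1) - 2 ^ (m + 1) : ℕ) : ZMod (2 ^ n)) ((2 ^ (n - 1) + 2 ^ m : ℕ) : ZMod (2 ^ n)) =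
      fermatCMType (2 ^ n) ((2 ^ (m + 1) : ℕ) : ZMod (2 ^ n)) ((2 ^ (n - 1) : ℕ) : ZMod (2 ^ n)) ((2 ^ (n - 1) - 2 ^ (m + 1) : ℕ) : ZMod (2 ^ n)) := by
  haveI : NeZero (2 ^ (n - m)) := ⟨by positivity⟩
  haveI : NeZero (2 ^ m * 2 ^ (n - m)) := ⟨by positivity⟩
  obtain ⟨h1, e1, e2, -, -, e5, -, e7, -, e9⟩ := twoPow_entries (show m + 2 ≤ n by omega)
  have h := fermatCMType_natCast_eq_transport₂ h1 (fermatCMType_twoPow_furthermore_eq_scaled (n := n) (m := m) hmn)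
  rwa [e1, e2, e5, e7, e9] at h

/-- **THEOREM 4 «Furthermore», EVERY `n` and `0 ≤ m ≤ n − 3`, at the level `2ⁿ`, second e)ₘ₊₁ triple**:
`H_{(2ᵐ, 2ⁿ⁻¹ − 2ᵐ⁺¹, 2ⁿ⁻¹ + 2ᵐ)} = H_{(2ᵐ⁺¹, 2ᵐ⁺¹, 2ⁿ − 2ᵐ⁺²)}` modulo `2ⁿ`. [cite: KoblitzRohrlich1978, Theorem 4 (p. 1186)] -/
theorem fermatCMType_twoPow_furthermore_snd_eq_at_level [NeZero (2 ^ n)] (hmn : m + 3 ≤ n) :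
    fermatCMType (2 ^ n) ((2 ^ m : ℕ) : ZMod (2 ^ n)) ((2 ^ (n - 1) - 2 ^ (m + 1) : ℕ) : ZMod (2 ^ n)) ((2 ^ (n - 1) + 2 ^ m : ℕ) : ZMod (2 ^ n)) =
      fermatCMType (2 ^ n) ((2 ^ (m + 1) : ℕ) : ZMod (2 ^ n)) ((2 ^ (m + 1) : ℕ) : ZMod (2 ^ n)) ((2 ^ n - 2 ^ (m + 2) : ℕ) : ZMod (2 ^ n)) := by
  haveI : NeZero (2 ^ (n - m)) := ⟨by positivity⟩
  haveI : NeZero (2 ^ m * 2 ^ (n - m)) := ⟨by positivity⟩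
  obtain ⟨h1, e1, -, -, -, e5, e6, e7, -, e9⟩ := twoPow_entries (show m + 2 ≤ n by omega)
  have h := fermatCMType_natCast_eq_transport₂ h1 (fermatCMType_twoPow_furthermore_snd_eq_scaled (n := n) (m := m) hmn)
  rwa [e1, e5, e6, e7, e9] at h

/-- **`N = 64`, a)₁ ∼ e)₂ × e)₂** (`n = 6`, `m = 1`): `H_{(2, 28, 34)} = H_{(4, 32, 28)}` and `H_{(2, 28, 34)} = H_{(4, 4, 56)}`.
[cite: KoblitzRohrlich1978, Theorem 4 (p. 1186)] -/
theorem fermatCMType_sixtyFour_furthermore_one :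
    fermatCMType 64 2 28 34 = fermatCMType 64 4 32 28 ∧ fermatCMType 64 2 28 34 = fermatCMType 64 4 4 56 := by
  have h := fermatCMType_twoPow_furthermore_eq_at_level (n := 6) (m := 1) (by norm_num)
  have h' := fermatCMType_twoPow_furthermore_snd_eq_at_level (n := 6) (m := 1) (by norm_num)
  norm_num at h h'
  exact ⟨h, h'⟩

end Furthermore

end CyclotomicFermatCMType

end Literature.AlgebraicGeometry.ComplexMultiplication
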